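import Summits.Ventures.CertifiedArithmetic.LowPrec.GemmThetaLawE2M1Sound

/-!
# The θ-certificate of E2M1² at every precision `p ≥ 9`: soundness of one checked edge

HONEST FRAMING (venture CertifiedArithmetic / cell `pub-lowprec`, seat gemm, gen 12): certified error
envelopes and provably optimal rounding/accumulation schemes for low-precision formats under stated
cost models; every table by two implementations; no hardware or vendor claims.

Soundness, part 2, of the symbolic certificate `GemmThetaLawE2M1Defs.lean` (paper `gemm.tex`
§Regimes Thm t:thetap): if `edgeOK σ c x = true` then, at EVERY admissible parameter `(H, T)`
(`2^m = 2H`, `H ≥ 128` even), the accumulation step from the state `v = ±(value of c)` by the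
letter `x` — computed by the integer rounding `rneZ m` of `GemmPrecRounding.lean` — lands on a
state of `stZ m` and satisfies the closure / potential / capacity / paid / free inequalities of the
θ-certificate with the potential `psiZp m` and `32 θ_p = 13H + 8` (`edge_sound`); a free move ends
on an even vertex of a binade `j' ≤ 6` with gain `≤ 2^{j'}`, and `pairEdgeOK` / `pairTableOK`
give the pair inequality `2(δ + δ') ≤ 23 d'` from every such vertex (`pair_sound`).
-/

namespace Literature.ComputerArithmetic.FloatingPoint

namespace MiniFloat

namespace ThetaLawE2M1

open ThetaE2M1 (lamQ)
open ThetaLaw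
open ThetaLaw.AForm (const smul)

/-! ### Unpacking the Boolean checks -/

/-- What `edgeOK = true` provides. [cell] -/
theorem edgeOK_spec {σ : Bool} {c : Cls} {x : ℤ} (h : edgeOK σ c x = true) :
    ∃ tg ψv ψw, symRne c.hasT c.hints (nF σ c x) = some tg ∧ psiV σ c = some ψv ∧
      psiW σ c.hasT tg = some ψw ∧ edgeBody σ c x tg ψv ψw = true := by
  unfold edgeOK at h
  split at h
  · exact absurd h Bool.false_ne_true
  · rename_i tg htg
    split at h
    · rename_i ψv ψw h1 h2
      exact ⟨tg, ψv, ψw, htg, h1, h2, h⟩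
    · exact absurd h Bool.false_ne_true

/-- What `pairEdgeOK = true` provides. [cell] -/
theorem pairEdgeOK_spec {σ : Bool} {jp : ℕ} {c : Cls} {x : ℤ} (h : pairEdgeOK σ jp c x = true) :
    ∃ tg, symRne c.hasT c.hints (nF σ c x) = some tg ∧ pairBody σ jp c x tg = true := by
  unfold pairEdgeOK at h
  split at h
  · exact absurd h Bool.false_ne_true
  · rename_i tg htg
    exact ⟨tg, htg, h⟩

/-! ### The step in integers -/

/-- `rneZ` commutes with the sign. [folklore] -/
theorem rneZ_sgnZ (m : ℕ) (σ : Bool) {N : ℤ} (hN : 0 ≤ N) :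
    rneZ m (sgnZ σ N) = sgnZ σ ((rneSigMag m N.toNat : ℕ) : ℤ) := by
  have h0 : rneZ m N = ((rneSigMag m N.toNat : ℕ) : ℤ) := by
    unfold rneZ; rw [if_neg (not_lt.mpr hN)]
    congr 2; omega
  unfold sgnZ
  split
  · rw [rneZ_neg, h0]
  · exact h0

/-- `sgnZ` is injective. [folklore] -/
theorem sgnZ_inj {σ : Bool} {a b : ℤ} : sgnZ σ a = sgnZ σ b ↔ a = b := by
  unfold sgnZ; split <;> constructor <;> intro h <;> linarith

/-- `|sgnZ σ a| = |a|`. [folklore] -/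
theorem natAbs_sgnZ (σ : Bool) (a : ℤ) : (sgnZ σ a).natAbs = a.natAbs := by
  unfold sgnZ; split <;> simp

/-- `ψ(sgnZ σ W) `: the magnitude on the negative side. [cell] -/
theorem psiZp_sgnZ_true (m : ℕ) {W : ℤ} (hW : 0 ≤ W) : psiZp m (sgnZ true W) = W := by
  simp only [sgnZ, if_true]; exact psiZp_neg_of_nonneg m hW

/-- THE STEP FROM A CLASS STATE, in integers: with `v = sgnZ σ |v|`, `|v|` the class value and
`tg` the symbolic target with constant offset, `fl(v + x) = sgnZ σ (target value)`, the gain is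
`sgnZ σ (offset)`, and the step is an absorption iff the gain is `-x`. [cell] -/
theorem step_sound {m : ℕ} {H T : ℤ} (hM : (2 : ℤ) ^ m = 2 * H) (hev : 2 ∣ H) {c : Cls}
    (hd : Dom c.hasT H T) {σ : Bool} {x : ℤ} {tg : Tgt}
    (hs : symRne c.hasT c.hints (nF σ c x) = some tg)
    (hb0 : (tg.val.sub (nF σ c x)).b = 0) (hc0 : (tg.val.sub (nF σ c x)).c = 0) :
    0 ≤ tg.val.eval H T ∧ 0 ≤ (nF σ c x).eval H T ∧
    rneZ m (sgnZ σ (c.valF.eval H T) + x) = sgnZ σ (tg.val.eval H T) ∧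
    rneZ m (sgnZ σ (c.valF.eval H T) + x) - sgnZ σ (c.valF.eval H T) - x
      = sgnZ σ (tg.val.sub (nF σ c x)).a ∧
    (rneZ m (sgnZ σ (c.valF.eval H T) + x) = sgnZ σ (c.valF.eval H T) ↔
      sgnZ σ (tg.val.sub (nF σ c x)).a = -x) := by
  obtain ⟨hN0, hW', -, -⟩ := symRne_sound hs hd hev hM
  have hVx : sgnZ σ (c.valF.eval H T) + x = sgnZ σ ((nF σ c x).eval H T) := by
    unfold sgnZ nF; split
    · rw [AForm.eval_sub, AForm.eval_const]; ring
    · rw [AForm.eval_add, AForm.eval_const]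
  have hW : rneZ m (sgnZ σ (c.valF.eval H T) + x) = sgnZ σ (tg.val.eval H T) := by
    rw [hVx, rneZ_sgnZ m σ hN0, hW']
  have hdl : (tg.val.sub (nF σ c x)).a = tg.val.eval H T - (nF σ c x).eval H T := by
    have : (tg.val.sub (nF σ c x)).eval H T = (tg.val.sub (nF σ c x)).a := by
      unfold AForm.eval; rw [hb0, hc0]; ring
    rw [← this, AForm.eval_sub]
  have hW0 : 0 ≤ tg.val.eval H T := by rw [← hW']; positivity
  have hδ : rneZ m (sgnZ σ (c.valF.eval H T) + x) - sgnZ σ (c.valF.eval H T) - x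
      = sgnZ σ (tg.val.sub (nF σ c x)).a := by
    rw [hW, hdl]; unfold sgnZ nF; split <;> simp <;> ring
  refine ⟨hW0, hN0, hW, hδ, ?_⟩
  rw [hW, sgnZ_inj, hdl]
  unfold sgnZ nF; split <;> simp <;> constructor <;> intro h <;> linarith

/-- Lower bound of a class value: `|v| ≥ 4H - 144 > 0`. [cell] -/
theorem valF_lower {H T : ℤ} (hH128 : 128 ≤ H) {c : Cls} (hc : c.valid) (hd : Dom c.hasT H T) :
    4 * H - 144 ≤ c.valF.eval H T := by
  have hu : ∀ j : ℕ, (2 : ℤ) ≤ 2 ^ (j + 1) := fun j =>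
    calc (2 : ℤ) = 2 ^ 1 := by norm_num
      _ ≤ 2 ^ (j + 1) := pow_le_pow_right₀ (by norm_num) (by omega)
  cases c with
  | qh z => simp only [Cls.valid] at hc; simp only [Cls.valF, AForm.eval_mk]; omega
  | low j t => have := hu j; simp only [Cls.valF, u, AForm.eval_mk]; nlinarith
  | mid j π =>
    have := hu j; obtain ⟨h36, -⟩ := hd.2.1 (by simp [Cls.hasT])
    simp only [Cls.valF, u, AForm.eval_mk]; nlinarith
  | high j s =>
    have := hu j; simp only [Cls.valid] at hc
    have hs : (s : ℤ) ≤ 72 := by exact_mod_cast hc.2.2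
    simp only [Cls.valF, u, AForm.eval_mk]; nlinarith

/-! ### Soundness of one checked edge -/

/-- SOUNDNESS OF `edgeOK`: the five edge facts of the θ-certificate at every admissible parameter,
for the state `v = sgnZ σ |c|` and the letter `x`, with `w = rneZ m (v + x)`, gain `δ = w - v - x`,
deficit `d = |x| - δ`, potential `psiZp m`, `32 θ_p = 13H + 8`; a free move ends on an even vertex
`sgnZ σ ((2H + t) u_{j'})`, `j' ≤ 6`, with `δ ≤ 2^{j'}`. [cell, gemm.tex Thm t:thetap] -/
theorem edge_sound {m : ℕ} (hm : 1 ≤ m) {H T : ℤ} (hM : (2 : ℤ) ^ m = 2 * H) (hH128 : 128 ≤ H)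
    (hev : 2 ∣ H) {c : Cls} (hc : c.valid) (hd : Dom c.hasT H T) {σ : Bool} {x : ℤ}
    (hok : edgeOK σ c x = true) :
    let v := sgnZ σ (c.valF.eval H T)
    let w := rneZ m (v + x)
    let δ := w - v - x
    let d := (x.natAbs : ℤ) - δ
    stZ m w ∧
    (w = v → x < 0 → (13 * H + 8) * -x ≤ 32 * psiZp m v) ∧
    (w ≠ v → psiZp m w ≤ psiZp m v + d) ∧
    (w ≠ v → 0 < d → 2 * δ ≤ 7 * d) ∧
    (w ≠ v → ¬ 0 < d → d = 0 ∧ (13 * H + 8) * δ ≤ 32 * psiZp m v ∧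
      ∃ jp : ℕ, ∃ t : ℤ, jp ≤ 6 ∧ 0 ≤ t ∧ t ≤ 2 * H ∧ 2 ∣ t ∧ δ ≤ 2 ^ jp ∧
        w = sgnZ σ ((2 * H + t) * 2 ^ (jp + 1))) := by
  intro v w δ d
  obtain ⟨tg, ψv, ψw, hs, hψv, hψw, hb⟩ := edgeOK_spec hok
  obtain ⟨-, -, hbig, hsmall⟩ := symRne_sound hs hd hev hM
  unfold edgeBody at hb
  simp only [Bool.and_eq_true, decide_eq_true_eq] at hb
  obtain ⟨⟨⟨hb0, hc0⟩, htgt⟩, hrest⟩ := hb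
  obtain ⟨hW0, hN0, hW, hδ, habs⟩ := step_sound hM hev hd hs hb0 hc0
  have hVlo := valF_lower hH128 hc hd
  -- the two potentials
  have hψV : psiZp m v = ψv.eval H T := by
    unfold psiV at hψv
    cases σ
    · simp only [Bool.false_eq_true, if_false] at hψv
      exact ((psiF_sound hm hM hH128 hc hd hψv).2).symm
    · simp only [if_true, Option.some.injEq] at hψv
      subst hψv
      exact psiZp_sgnZ_true m (by linarith)
  have hψW : psiZp m w = ψw.eval H T := by
    show psiZp m (rneZ m (v + x)) = _
    rw [hW]
    unfold psiW at hψw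
    cases σ
    · simp only [Bool.false_eq_true, if_false] at hψw
      simp only [sgnZ, Bool.false_eq_true, if_false]
      cases tg with
      | big e sig =>
        rw [psiTgt_big_sound hm hM hd hψw]
        simp only [Tgt.val, AForm.eval_smul]; ring_nf
      | small n' =>
        obtain ⟨rfl, hlt⟩ := hsmall n' rfl
        simp only [psiTgt, Option.some.injEq] at hψw
        subst hψw
        simp only [Tgt.val]
        exact psiZp_of_small m hN0 (by rw [pow_succ, hM]; linarith)
    · simp only [if_true, Option.some.injEq] at hψw
      subst hψw
      exact psiZp_sgnZ_true m hW0
  refine ⟨?_, ?_, ?_, ?_, ?_⟩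
  · -- closure
    show stZ m (rneZ m (v + x))
    rw [hW]
    unfold stZ
    rw [natAbs_sgnZ]
    cases tg with
    | small n' =>
      obtain ⟨rfl, hlt⟩ := hsmall n' rfl
      left
      show ((nF σ c x).eval H T).natAbs < 2 ^ (m + 1)
      have : (((nF σ c x).eval H T).natAbs : ℤ) < (2 : ℤ) ^ (m + 1) := by
        rw [Int.natAbs_of_nonneg hN0, pow_succ, hM]; linarith
      exact_mod_cast this
    | big e sig =>
      obtain ⟨hs1, hs2⟩ := hbig e sig rfl
      right
      simp only [tgtOK, Bool.and_eq_true, Bool.or_eq_true, decide_eq_true_eq] at htgt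
      obtain ⟨he1, he⟩ := htgt
      have hval : (Tgt.big e sig).val.eval H T = sig.eval H T * 2 ^ e := by
        simp only [Tgt.val, AForm.eval_smul]; ring
      rcases he with he8 | ⟨he9, htop⟩
      · refine ⟨e - 1, (sig.eval H T - 2 * H).toNat, by omega, ?_, ?_⟩
        · have : (((sig.eval H T - 2 * H).toNat : ℕ) : ℤ) ≤ ((2 ^ m : ℕ) : ℤ) := by
            rw [Int.toNat_of_nonneg (by linarith)]; push_cast; rw [hM]; linarith
          exact_mod_cast this
        · have : ((((Tgt.big e sig).val.eval H T).natAbs : ℕ) : ℤ)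
              = (((2 ^ m + (sig.eval H T - 2 * H).toNat) * 2 ^ (e - 1 + 1) : ℕ) : ℤ) := by
            rw [Int.natAbs_of_nonneg hW0, hval, show e - 1 + 1 = e by omega]
            push_cast; rw [Int.toNat_of_nonneg (by linarith), hM]; ring
          exact_mod_cast this
      · have htop' := nonnegOn_sound htop hd
        simp only [AForm.eval_sub, AForm.eval_hH] at htop'
        have hsig : sig.eval H T = 2 * H := by linarith
        refine ⟨7, 2 ^ m, le_rfl, le_rfl, ?_⟩
        have : ((((Tgt.big e sig).val.eval H T).natAbs : ℕ) : ℤ)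
            = (((2 ^ m + 2 ^ m) * 2 ^ (7 + 1) : ℕ) : ℤ) := by
          rw [Int.natAbs_of_nonneg hW0, hval, hsig, he9]; push_cast; rw [hM]; ring
        exact_mod_cast this
  · -- capacity
    intro hwv hx
    have hδx : sgnZ σ (tg.val.sub (nF σ c x)).a = -x := habs.mp hwv
    rw [if_pos hδx] at hrest
    simp only [Bool.or_eq_true, decide_eq_true_eq] at hrest
    rcases hrest with h | h
    · omega
    · have h' := nonnegOn_sound h hd
      simp only [AForm.eval_sub, AForm.eval_smul, AForm.eval_mk] at h'
      rw [hψV]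
      have hxa : ((x.natAbs : ℕ) : ℤ) = -x := by omega
      rw [hxa] at h'
      nlinarith
  · -- potential
    intro hwv
    have hδx : ¬ sgnZ σ (tg.val.sub (nF σ c x)).a = -x := fun h => hwv (habs.mpr h)
    rw [if_neg hδx] at hrest
    simp only [Bool.and_eq_true] at hrest
    have h' := nonnegOn_sound hrest.1 hd
    simp only [AForm.eval_sub, AForm.eval_add, AForm.eval_const] at h'
    rw [hψV, hψW]
    show ψw.eval H T ≤ ψv.eval H T + ((x.natAbs : ℤ) - (rneZ m (v + x) - v - x))
    rw [hδ]; linarith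
  · -- paid
    intro hwv hdpos
    have hδx : ¬ sgnZ σ (tg.val.sub (nF σ c x)).a = -x := fun h => hwv (habs.mpr h)
    rw [if_neg hδx] at hrest
    simp only [Bool.and_eq_true] at hrest
    have h2 := hrest.2
    have hdpos' : 0 < (x.natAbs : ℤ) - sgnZ σ (tg.val.sub (nF σ c x)).a := by
      change (0 : ℤ) < (x.natAbs : ℤ) - (rneZ m (v + x) - v - x) at hdpos
      rwa [hδ] at hdpos
    rw [if_pos hdpos'] at h2
    simp only [decide_eq_true_eq] at h2
    show 2 * (rneZ m (v + x) - v - x) ≤ 7 * ((x.natAbs : ℤ) - (rneZ m (v + x) - v - x))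
    rw [hδ]; exact h2
  · -- free
    intro hwv hdnp
    have hδx : ¬ sgnZ σ (tg.val.sub (nF σ c x)).a = -x := fun h => hwv (habs.mpr h)
    rw [if_neg hδx] at hrest
    simp only [Bool.and_eq_true] at hrest
    have h2 := hrest.2
    have hdnp' : ¬ 0 < (x.natAbs : ℤ) - sgnZ σ (tg.val.sub (nF σ c x)).a := by
      change ¬ (0 : ℤ) < (x.natAbs : ℤ) - (rneZ m (v + x) - v - x) at hdnp
      rwa [hδ] at hdnp
    rw [if_neg hdnp'] at h2
    simp only [Bool.and_eq_true, decide_eq_true_eq] at h2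
    obtain ⟨⟨hd0, hκ⟩, hfree⟩ := h2
    have hκ' := nonnegOn_sound hκ hd
    simp only [AForm.eval_sub, AForm.eval_smul, AForm.eval_mk] at hκ'
    refine ⟨?_, ?_, ?_⟩
    · show (x.natAbs : ℤ) - (rneZ m (v + x) - v - x) = 0
      rw [hδ]; exact hd0
    · show (13 * H + 8) * (rneZ m (v + x) - v - x) ≤ 32 * psiZp m v
      rw [hδ, hψV]; nlinarith
    · cases tg with
      | small n' => simp [freeTgtOK] at hfree
      | big e sig =>
        simp only [freeTgtOK, Bool.and_eq_true, decide_eq_true_eq] at hfree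
        obtain ⟨⟨⟨⟨⟨he1, he7⟩, hδe⟩, hpa⟩, hpb⟩, hpc⟩ := hfree
        obtain ⟨hs1, hs2⟩ := hbig e sig rfl
        refine ⟨e - 1, sig.eval H T - 2 * H, by omega, by linarith, by linarith, ?_, ?_, ?_⟩
        · -- parity of `t' = sig - 2H` from the even coefficients
          have ht : sig.eval H T - 2 * H = (sig.sub (AForm.hH 2)).eval H T := by
            simp [AForm.eval_sub, AForm.eval_hH]
          rw [ht]
          unfold AForm.eval
          obtain ⟨a', ha'⟩ := Int.dvd_of_emod_eq_zero hpa
          obtain ⟨b', hb'⟩ := Int.dvd_of_emod_eq_zero hpb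
          obtain ⟨c', hc'⟩ := Int.dvd_of_emod_eq_zero hpc
          rw [ha', hb', hc']
          exact ⟨a' + b' * H + c' * T, by ring⟩
        · show rneZ m (v + x) - v - x ≤ 2 ^ (e - 1)
          rw [hδ]; exact hδe
        · show rneZ m (v + x) = _
          rw [hW, show e - 1 + 1 = e by omega]
          simp only [Tgt.val, AForm.eval_smul]
          congr 1; ring

/-! ### Soundness of the pair table -/

/-- SOUNDNESS OF `pairEdgeOK`: from the state `v = sgnZ σ |c|` the letter `x` is absorbed or
`2(2^{j'} + δ') ≤ 23 d'`. [cell] -/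
theorem pairEdge_sound {m : ℕ} {H T : ℤ} (hM : (2 : ℤ) ^ m = 2 * H) (hev : 2 ∣ H) {c : Cls}
    (hd : Dom c.hasT H T) {σ : Bool} {jp : ℕ} {x : ℤ} (hok : pairEdgeOK σ jp c x = true) :
    let v := sgnZ σ (c.valF.eval H T)
    let w := rneZ m (v + x)
    w = v ∨ 2 * (2 ^ jp + (w - v - x)) ≤ 23 * ((x.natAbs : ℤ) - (w - v - x)) := by
  intro v w
  obtain ⟨tg, hs, hb⟩ := pairEdgeOK_spec hok
  unfold pairBody at hb
  simp only [Bool.and_eq_true, Bool.or_eq_true, decide_eq_true_eq] at hb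
  obtain ⟨⟨hb0, hc0⟩, h⟩ := hb
  obtain ⟨-, -, hW, hδ, habs⟩ := step_sound hM hev hd hs hb0 hc0
  rcases h with h | h
  · exact Or.inl (habs.mpr h)
  · right
    show 2 * (2 ^ jp + (rneZ m (v + x) - v - x)) ≤ 23 * ((x.natAbs : ℤ) - (rneZ m (v + x) - v - x))
    rw [hδ]; exact h

/-- SOUNDNESS OF THE PAIR TABLE: from every even vertex `v = sgnZ σ ((2H + t) u_{j'})`
(`0 ≤ t ≤ 2H` even) every letter of `lamQ` is absorbed or satisfies `2(2^{j'} + δ') ≤ 23 d'`.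
[cell, gemm.tex Lemma "moving walks"] -/
theorem pair_sound {m : ℕ} {H : ℤ} (hM : (2 : ℤ) ^ m = 2 * H) (hH128 : 128 ≤ H) (hev : 2 ∣ H)
    {jp : ℕ} (htab : pairTableOK jp = true) {t : ℤ} (ht0 : 0 ≤ t) (ht : t ≤ 2 * H) (h2 : 2 ∣ t)
    (σ : Bool) {x : ℤ} (hx : x ∈ lamQ) :
    let v := sgnZ σ ((2 * H + t) * 2 ^ (jp + 1))
    let w := rneZ m (v + x)
    w = v ∨ 2 * (2 ^ jp + (w - v - x)) ≤ 23 * ((x.natAbs : ℤ) - (w - v - x)) := by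
  intro v w
  obtain ⟨c, hc, T, hd, hval⟩ := cover_even hM hH128 (jp := jp) ht0 ht h2
  have h1 := List.all_eq_true.mp (List.all_eq_true.mp htab c hc) x hx
  rw [Bool.and_eq_true] at h1
  have hok : pairEdgeOK σ jp c x = true := by cases σ <;> simp [h1.1, h1.2]
  have := pairEdge_sound hM hev hd hok
  simp only [hval] at this
  exact this

end ThetaLawE2M1

end MiniFloat

end Literature.ComputerArithmetic.FloatingPoint
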